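import Summits.BirchSwinnertonDyer.BirchSwinnertonDyer.Theorems.ManinLocalTwoThreeUDCLineKAtNine
import Summits.BirchSwinnertonDyer.Rank1Residual.ManinAdditive.UDCKummerLineK
import Summits.BirchSwinnertonDyer.Rank1Residual.ManinAdditive.ShimuraThreeTorsion
import Summits.BirchSwinnertonDyer.Rank1Residual.ManinAdditive.CuspidalKummerCubeLaws
import HarnessLib

/-!
# RES₃♭ ⟸ EXISTC ∧ (BI)_K ∧ (AN)_K ∧ E-an-221 — the Shimura branch of the K-line is EMPTY under RES₃♭'s own hypothesis (-an g39 file F PART B, landed by the C3 LEAD p1 g16)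
(route `ManinLocalTwoThree`, crux C3 `ManinPrimeToThreeAtNine` stmt-BirchSwinnertonDyer-22968; cell bsd-f2-manin; `--supports stmt-BirchSwinnertonDyer-22968`; ask L-an-g39-3)

LANDING NOTE (lead p1 g16).  SOURCE = HOME/an/g39/ShimuraThreeTorsion-an-g39.lean sha16 3b4b01ee452301e0 (-an g39: rc 0 · 0 warn · 0 sorry, std axioms,
BC7 CLEAN; ref1 R-an-77 asked).  PART A (the `@[conjecture]` node E-an-221 `ShimuraThreeTorsion.ShimuraThreeKernelForcesRationalThreeTorsionAtNine`) is the
tree module `Summits/BirchSwinnertonDyer/Rank1Residual/ManinAdditive/ShimuraThreeTorsion.lean` (ty g21, T-an-49); this file is PART B VERBATIM (namespace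
`Summit.BirchSwinnertonDyer.BirchSwinnertonDyer.Theorems.ManinLocalTwoThree`) with the inlined PART A replaced by the import.

CONTENT (MEMO-an §83.11).  RES₃♭ carries «no rational point of order 3 on `E_{W,c}`».  In the landed K-line split (`…UDCLineKAtNine`, p735594) the lifted
`K`-point either has a NON-Shimura Kummer class — KLINE♮ ⟸ NCΣ (proved) ∧ (BI)_K ∧ (AN)_K — or is Kummer–Shimura, where E-an-221 (optimal, `9 ∣ N`,
Shimura `3`-kernel ⟹ a RATIONAL point of order 3; Mazur's Σ/C duality at prime level, census 27a1/54a1 only at `9 ∣ N ≤ 386`) contradicts the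
hypothesis.  PROVED: `noRationalThreeTorsionCoprimeIsolatedResidual_of_kLine_sigmaTorsion : EXISTC → KLINE♮ → E-an-221 → RES₃♭`,
`…_of_kPieces_sigmaTorsion : EXISTC → (BI)_K → (AN)_K → E-an-221 → RES₃♭`, `…_udc` ((AN)_K ⟸ (AN♮)_K ∧ ∀ k, UDW-algInt k).  EXISTC is a THEOREM
(`KummerCover.reducibleShortThreeTorsionLiftC_holds`, lead p735052/p736545), so the C3 skeleton v30 reads RES₃♭ ⟸ {(BI)_K, (AN♮)_K, CDT-algInt, E-an-221}.
HONEST FRAMING.  CONDITIONAL reduction; E-an-221 is a cell conjecture (finite census + prime-level theorem), (BI)_K/(AN♮)_K are open K-pieces; RES₃♭, C3, Manin's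
conjecture and BSD are NOT proved.  No definitions, no sorry.
[cite: LingOesterle1991, Thm. 1] [cite: Mazur1977, Prop. II.11.7] [cite: Vatsal2005, §1 Rem. 1.8]
-/

set_option autoImplicit false
-- lint-debt: the directory name repeats the summit name (sibling precedent `ManinLocalTwoThreeUDCLineKAtNine.lean`)
set_option linter.dupNamespace false

noncomputable section

open scoped Classical
open WeierstrassCurve Literature.NumberTheory.EllipticCurves Literature.NumberTheory.EllipticCurves.ModularForms
open Summit.BirchSwinnertonDyer.Rank1Residual.ManinAdditive.CuspidalKummer
open Summit.BirchSwinnertonDyer.Rank1Residual.ManinAdditive.CuspidalKummerThree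
open Summit.BirchSwinnertonDyer.Rank1Residual.ManinAdditive.UDCKummerLine
open Summit.BirchSwinnertonDyer.Rank1Residual.ManinAdditive.UDCKummerLineK


namespace Summit.BirchSwinnertonDyer.BirchSwinnertonDyer.Theorems.ManinLocalTwoThree

open Summit.BirchSwinnertonDyer.Rank1Residual.ManinAdditive.ShimuraThreeTorsion

/-- **RES₃♭ ⟸ EXISTC ∧ KLINE♮ ∧ E-an-221 (PROVED).**  Lift a reducible line to a `K`-point `T` with analytic lift `u` (EXISTC); if its
Kummer class is not Shimura, the `K`-rational UDC line KLINE♮ gives `3 ∤ c`; if it is Shimura, E-an-221 produces a rational point of order 3,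
contradicting RES₃♭'s hypothesis.  No GENΣ, no E-an-201, no RESΣ. [folklore] -/
theorem noRationalThreeTorsionCoprimeIsolatedResidual_of_kLine_sigmaTorsion
    (hEX : ReducibleShortThreeTorsionLiftC) (hKL : NonShimuraThreeTorsionCaseAtNineGermFree)
    (h221 : ShimuraThreeKernelForcesRationalThreeTorsionAtNine) :
    NoRationalThreeTorsionCoprimeIsolatedResidual := by
  intro W _ _ N _ D hL h9 _ _ _ _ _ _ _ hred hT
  obtain ⟨X₀, Y₀, u, hTC, _, hu₁, hu₂, hX, hY⟩ := hEX W D hred hT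
  by_cases hS : KummerShimura D u
  · obtain ⟨X, Y, hXY⟩ := h221 W D hL h9 u hu₁ hu₂ hS
    exact absurd hXY (hT X Y)
  · exact hKL W D h9 hL X₀ Y₀ hTC u hu₁ hu₂ hX hY hS

/-- **NET (PROVED): RES₃♭ ⟸ EXISTC ∧ (BI)_K ∧ (AN)_K ∧ E-an-221** — KLINE♮ from the landed `nonShimuraThreeTorsionCaseAtNineGermFree_of_pieces`
(NCΣ proved, (BI)_K, (AN)_K). [folklore] -/
theorem noRationalThreeTorsionCoprimeIsolatedResidual_of_kPieces_sigmaTorsion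
    (hEX : ReducibleShortThreeTorsionLiftC) (hBI : KummerCubeRootThreeBoundedK) (hAN : KummerCubeRootCongruenceOfBoundedK)
    (h221 : ShimuraThreeKernelForcesRationalThreeTorsionAtNine) :
    NoRationalThreeTorsionCoprimeIsolatedResidual :=
  noRationalThreeTorsionCoprimeIsolatedResidual_of_kLine_sigmaTorsion hEX
    (nonShimuraThreeTorsionCaseAtNineGermFree_of_pieces hBI hAN) h221

/-- **Same with (AN)_K fed by UDC with algebraic-integer coefficients (all weights).** [folklore] -/
theorem noRationalThreeTorsionCoprimeIsolatedResidual_of_kPieces_sigmaTorsion_udc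
    (hEX : ReducibleShortThreeTorsionLiftC) (hBI : KummerCubeRootThreeBoundedK)
    (hANofUDC : KummerCubeRootCongruenceOfBoundedKOfUDC) (hUDW : ∀ k : ℤ, UnboundedDenominatorsWeightAlgInt k)
    (h221 : ShimuraThreeKernelForcesRationalThreeTorsionAtNine) :
    NoRationalThreeTorsionCoprimeIsolatedResidual :=
  noRationalThreeTorsionCoprimeIsolatedResidual_of_kPieces_sigmaTorsion hEX hBI (hANofUDC hUDW) h221

end Summit.BirchSwinnertonDyer.BirchSwinnertonDyer.Theorems.ManinLocalTwoThree

end
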